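import Mathlib
import HarnessLib
import Summits.HubbardSuperconductivity.HubbardSuperconductivity.Theses.BalabanIR
import Summits.HubbardSuperconductivity.HubbardSuperconductivity.Theorems.BalabanIRBirComplexStableXYRPositivityCore

/-!
# BalabanIR: the typed engine `BirComplexStableXYR` is secretly POSITIVE
# (stmt-14845; first antecedent of the reduction `BirGappedPhaseReductionR`, stmt-14846)

Support file for route BalabanIR (`--supports stmt-HubbardSuperconductivity-14846`; prover seat 2,
session 10).  Main results (all statements are the crux `Theses.BalabanIR.BirComplexStableXYR`
VERBATIM up to the displayed change of conclusion; same thresholds `K₀, L₀`):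

* `birComplexStableXYR_pos` — `BirComplexStableXYR →` (verbatim crux with conclusion
  `0 < Re Z ∧ Im Z = 0 ∧ 1/2 ≤ Re(∫ O e^{−A}) / Re Z`).  Proof (core file): the admissible class is
  convex and closed under the reflection-conjugate `c ↦ c'`; the real-part table `(c+c')/2` is
  admissible with `Z > 0`; along the admissible segment to `c` the partition function is real ((R),
  `partitionFunction_conj_eq_self`), continuous and — by the crux — never zero, so it stays positive
  (intermediate value theorem).
* `birComplexStableXYR_of_pos`, `birComplexStableXYR_iff_pos` — the converse is trivial, so the crux
  is EQUIVALENT to its positive form: the "positivity-free" infrared engine as typed asserts that EVERY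
  admissible complex table has a positive partition function at all even `M ≥ L ≥ L₀`, `K ≥ K₀`.
  For window depth `r ≥ 3` the transfer operator of an admissible table is only `J`-self-adjoint
  (time reflection composed with conjugation), not Hermitian, and at unbounded `M` the sign of
  `Z_M = tr T^M` follows its peripheral spectrum — so the crux contains a Perron–Frobenius-type claim
  for every admissible non-Hermitian transfer operator; a single admissible table with `Re Z < 0` at
  one admissible `(K, L, M)` beyond the thresholds refutes it (an OPEN condition, unlike `Z = 0`).
* `birGappedPhaseReductionR_of_pos`, `birGappedPhaseReductionR_iff_pos` — for item stmt-14846: the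
  re-typed reduction is EQUIVALENT to the reduction from the POSITIVE engine; a prover of 4R may
  assume positive class partition functions (real free energies along admissible segments).

No definitions; conditional closers are glue by design (the item is an implication between open route
declarations). [folklore]
-/

noncomputable section

namespace Summit.HubbardSuperconductivity.HubbardSuperconductivity.Theorems

open scoped BigOperators ComplexConjugate
open MeasureTheory Literature.Probability.LatticeModels
open Summit.HubbardSuperconductivity.BirComplexStableXYNegative
open Summit.HubbardSuperconductivity.HubbardSuperconductivity.Theses.BalabanIR

/-! ### The hidden positivity of the typed engine `BirComplexStableXYR` -/

/-- **Hidden positivity of the restated engine.** `Theses.BalabanIR.BirComplexStableXYR` (crux 2R,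
stmt-14845; the first antecedent of `BirGappedPhaseReductionR`, stmt-14846) implies its POSITIVE form:
the statement below is the crux VERBATIM with the conclusion `Z ≠ 0 ∧ 1/2 ≤ Re(∫O e^{-A} / Z)`
replaced by `0 < Re Z ∧ Im Z = 0 ∧ 1/2 ≤ Re(∫O e^{-A}) / Re Z` — with the SAME thresholds `K₀, L₀`.
Proof: the admissible class is convex and closed under the reflection-conjugate `c ↦ c'`,
`c' n = conj (c (-n))`; the real-part table `(c+c')/2` is admissible with the same `B, c₀` and has
`Z > 0`; along the admissible segment `c_t = (1-t)(c+c')/2 + t c` the partition function is real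
((R), `partitionFunction_conj_eq_self`), continuous in `t` and never zero (the crux), so by the
intermediate value theorem it stays positive up to `t = 1`.  So the "positivity-free" engine as typed
asserts, for EVERY admissible complex table and all even `M ≥ L ≥ L₀`, `K ≥ K₀`, a positive partition
function. -/
theorem birComplexStableXYR_pos (h2R : BirComplexStableXYR) :
    (∀ (r : ℕ) (B c₀ : ℝ), 2 ≤ r → 0 < c₀ → ∃ K₀ : ℝ, ∃ L₀ : ℕ, ∀ K : ℝ, K₀ ≤ K → ∀ c : ((Fin r × Fin r × Fin r) → ℤ) →₀ ℂ, (∀ n ∈ c.support, ∑ w, n w = 0) → c.sum (fun _ a => a) = 0 → c.sum (fun n a => ‖a‖ * Real.exp (∑ w, |(n w : ℝ)|)) ≤ B → (∀ φ : (Fin r × Fin r × Fin r) → ℝ, c₀ * ∑ w, ∑ w', (1 - Real.cos (φ w - φ w')) ≤ ((fun (φ : (Fin r × Fin r × Fin r) → ℝ) => c.sum (fun n a => a * Complex.exp (Complex.I * ((∑ w, (n w : ℝ) * φ w : ℝ) : ℂ)))) φ).re) → (∀ n : (Fin r × Fin r × Fin r) → ℤ, c (fun w => n (w.1, w.2.1,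 Fin.rev w.2.2)) = (starRingEnd ℂ) (c (-n))) → (∀ n : (Fin r × Fin r × Fin r) → ℤ, c (fun w => n (Fin.rev w.1, Fin.rev w.2.1, w.2.2)) = c n) → ∀ (L M : ℕ) [NeZero L] [NeZero M], L₀ ≤ L → L ≤ M → Even L → Even M → let sh : (Literature.Probability.LatticeModels.TorusSite 2 L × ZMod M) → (Fin r × Fin r × Fin r) → (Literature.Probability.LatticeModels.TorusSite 2 L × ZMod M) := fun s w => (s.1 + ![((w.1 : ℕ) : ZMod L), ((w.2.1 : ℕ) : ZMod L)], s.2 + ((w.2.2 : ℕ) : ZMod M)); let F : ((Fin r × Fin r × Fin r) → ℝ) → ℂ := fun (φ : (Fin r × Fin r × Fin r) → ℝ) => c.sum (fun n a => a * Complex.exp (Complex.I * ((∑ w, (n w : ℝ) * φ w : ℝ) : ℂ))); let A : ((Literature.Probability.LatticeModels.TorusSite 2 L × ZMod M) → ℝ) → ℂ := fun θ => (K : ℂ) * ∑ s : (Literature.Probability.LatticeModels.TorusSite 2 L × ZMod M), F (fun w => θ (sh s w)); let cube : Set ((Literature.Probability.LatticeModels.TorusSite 2 L × ZMod M) → ℝ)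 := Set.pi Set.univ (fun _ => Set.Icc (0:ℝ) (2 * Real.pi)); let Z : ℂ := MeasureTheory.integral (MeasureTheory.volume.restrict cube) (fun θ => Complex.exp (-(A θ))); let O : ((Literature.Probability.LatticeModels.TorusSite 2 L × ZMod M) → ℝ) → ℝ := fun θ => ‖∑ x : Literature.Probability.LatticeModels.TorusSite 2 L, Complex.exp (Complex.I * (θ (x, 0) : ℂ))‖ ^ 2 / (L : ℝ) ^ 4; 0 < Z.re ∧ Z.im = 0 ∧ (1/2 : ℝ) ≤ (MeasureTheory.integral (MeasureTheory.volume.restrict cube) (fun θ => (O θ : ℂ) * Complex.exp (-(A θ)))).re / Z.re) := by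
  intro r B c₀ hr hc₀
  obtain ⟨K₀, L₀, H⟩ := h2R r B c₀ hr hc₀
  refine ⟨K₀, L₀, ?_⟩
  intro K hK c hU1 hN hA hC hR hP L M _ _ hL0 hLM hLe hMe
  -- named forms of the class hypotheses on `c`
  have hN' : BirComplexStableXYNegative.tsum c = 0 := hN
  have hA' : normA c ≤ B := hA
  have hC' : ∀ φ : W r → ℝ, c₀ * ∑ w, ∑ w', (1 - Real.cos (φ w - φ w')) ≤ (genF c φ).re := hC
  -- the reflection-conjugate table `c'`
  obtain ⟨c', hcc⟩ : ∃ c' : Table r, ∀ n, c' n = conj (c (-n)) := ⟨_, conjReflect_apply c⟩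
  -- every segment table is admissible, so the crux applies to it: `Z_{c_t} ≠ 0`, and `Z_{c_t}` is real
  have hseg : ∀ t ∈ Set.Icc (0:ℝ) 1,
      partZ K ((((1 - t : ℝ)) : ℂ) • ((1/2 : ℂ) • (c + c')) + ((t : ℝ) : ℂ) • c) L M ≠ 0 ∧
      (partZ K ((((1 - t : ℝ)) : ℂ) • ((1/2 : ℂ) • (c + c')) + ((t : ℝ) : ℂ) • c) L M).im = 0 := by
    intro t ht
    obtain ⟨ht0, ht1⟩ := ht
    have h1t : 0 ≤ 1 - t := sub_nonneg.mpr ht1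
    have sU1 : ∀ n ∈ ((((1 - t : ℝ)) : ℂ) • ((1/2 : ℂ) • (c + c')) + ((t : ℝ) : ℂ) • c).support,
        ∑ w, n w = 0 :=
      condU1_add (condU1_smul _ (condU1_realPart c c' hcc hU1)) (condU1_smul _ hU1)
    have sN : BirComplexStableXYNegative.tsum
        ((((1 - t : ℝ)) : ℂ) • ((1/2 : ℂ) • (c + c')) + ((t : ℝ) : ℂ) • c) = 0 := by
      rw [tsum_lincomb, tsum_realPart c c' hcc hN', hN', mul_zero, mul_zero, add_zero]
    have sA : normA ((((1 - t : ℝ)) : ℂ) • ((1/2 : ℂ) • (c + c')) + ((t : ℝ) : ℂ) • c) ≤ B := by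
      refine (normA_lincomb_le h1t ht0 _ _).trans ?_
      have h1 := normA_realPart_le c c' hcc
      have h2 := normA_nonneg c
      nlinarith
    have sC : ∀ φ : W r → ℝ, c₀ * ∑ w, ∑ w', (1 - Real.cos (φ w - φ w')) ≤
        (genF ((((1 - t : ℝ)) : ℂ) • ((1/2 : ℂ) • (c + c')) + ((t : ℝ) : ℂ) • c) φ).re := by
      intro φ
      rw [re_genF_segment c c' hcc]
      exact hC' φ
    have sR := condR_real_lincomb (1 - t) t _ _ (condR_realPart c c' hcc hR) hR
    have sP := condP_lincomb (((1 - t : ℝ)) : ℂ) ((t : ℝ) : ℂ) _ _ (condP_realPart c c' hcc hP) hP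
    have raw := H K hK _ sU1 sN sA sC sR sP L M hL0 hLM hLe hMe
    dsimp only at raw
    have real := partitionFunction_conj_eq_self r _ K L M (timeReflection_functional_of_table r _ sR)
    dsimp only at real
    constructor
    · have h1 := raw.1
      dsimp only [partZ, action, genF, sh, cube]
      exact h1
    · have h2 : conj (partZ K ((((1 - t : ℝ)) : ℂ) • ((1/2 : ℂ) • (c + c')) + ((t : ℝ) : ℂ) • c) L M)
          = partZ K ((((1 - t : ℝ)) : ℂ) • ((1/2 : ℂ) • (c + c')) + ((t : ℝ) : ℂ) • c) L M := by
        dsimp only [partZ, action, genF, sh, cube]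
        exact real
      exact Complex.conj_eq_iff_im.mp h2
  have hpos : 0 < (partZ K c L M).re :=
    re_partZ_pos_of_segment K c c' hcc L M (fun t ht => (hseg t ht).1) (fun t ht => (hseg t ht).2)
  -- reality of `Z` and of the slice-order numerator for `c`, and the crux's order clause
  have hRf := timeReflection_functional_of_table r c hR
  have hZreal : conj (partZ K c L M) = partZ K c L M := by
    have h1 := partitionFunction_conj_eq_self r c K L M hRf
    dsimp only at h1
    dsimp only [partZ, action, genF, sh, cube]
    exact h1
  have hNreal : conj (∫ θ, ((((‖∑ x : TorusSite 2 L, Complex.exp (Complex.I * (θ (x, 0) : ℂ))‖ ^ 2 / (L : ℝ) ^ 4 : ℝ)) : ℂ) * Complex.exp (-(action K c L M θ))) ∂(volume.restrict (cube L M))) = (∫ θ, ((((‖∑ x : TorusSite 2 L, Complex.exp (Complex.I * (θ (x, 0) : ℂ))‖ ^ 2 / (L : ℝ) ^ 4 : ℝ)) : ℂ) * Complex.exp (-(action K c L M θ))) ∂(volume.restrict (cube L M))) := by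
    have h1 := sliceOrderNumerator_conj_eq_self r c K L M hRf
    dsimp only at h1
    dsimp only [action, genF, sh, cube]
    exact h1
  have hord : (1/2 : ℝ) ≤ ((∫ θ, ((((‖∑ x : TorusSite 2 L, Complex.exp (Complex.I * (θ (x, 0) : ℂ))‖ ^ 2 / (L : ℝ) ^ 4 : ℝ)) : ℂ) * Complex.exp (-(action K c L M θ))) ∂(volume.restrict (cube L M))) / partZ K c L M).re := by
    have h1 := H K hK c hU1 hN hA hC hR hP L M hL0 hLM hLe hMe
    dsimp only at h1
    have h2 := h1.2
    dsimp only [partZ, action, genF, sh, cube]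
    exact h2
  have key : 0 < (partZ K c L M).re ∧ (partZ K c L M).im = 0 ∧
      (1/2 : ℝ) ≤ (∫ θ, ((((‖∑ x : TorusSite 2 L, Complex.exp (Complex.I * (θ (x, 0) : ℂ))‖ ^ 2 / (L : ℝ) ^ 4 : ℝ)) : ℂ) * Complex.exp (-(action K c L M θ))) ∂(volume.restrict (cube L M))).re / (partZ K c L M).re := by
    refine ⟨hpos, Complex.conj_eq_iff_im.mp hZreal, ?_⟩
    rw [← (re_div_of_conj_eq_self hZreal hNreal).2]
    exact hord
  dsimp only [partZ, action, genF, sh, cube] at key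
  dsimp only
  exact key

/-- Conversely the positive form gives back the crux as typed (trivially: `0 < Re Z ⇒ Z ≠ 0`, and
the slice-order numerator is real by (R), so `Re(N/Z) = Re N / Re Z`). -/
theorem birComplexStableXYR_of_pos
    (hpos : (∀ (r : ℕ) (B c₀ : ℝ), 2 ≤ r → 0 < c₀ → ∃ K₀ : ℝ, ∃ L₀ : ℕ, ∀ K : ℝ, K₀ ≤ K → ∀ c : ((Fin r × Fin r × Fin r) → ℤ) →₀ ℂ, (∀ n ∈ c.support, ∑ w, n w = 0) → c.sum (fun _ a => a) = 0 → c.sum (fun n a => ‖a‖ * Real.exp (∑ w, |(n w : ℝ)|)) ≤ B → (∀ φ : (Fin r × Fin r × Fin r) → ℝ, c₀ * ∑ w, ∑ w', (1 - Real.cos (φ w - φ w')) ≤ ((fun (φ : (Fin r × Fin r × Fin r) → ℝ) => c.sum (fun n a => a * Complex.exp (Complex.I * ((∑ w, (n w : ℝ) * φ w : ℝ) : ℂ)))) φ).re) → (∀ n : (Fin r × Fin r × Fin r) → ℤ, c (fun w => n (w.1, w.2.1, Fin.rev w.2.2)) = (starRingEnd ℂ) (c (-n))) → (∀ n : (Fin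 r × Fin r × Fin r) → ℤ, c (fun w => n (Fin.rev w.1, Fin.rev w.2.1, w.2.2)) = c n) → ∀ (L M : ℕ) [NeZero L] [NeZero M], L₀ ≤ L → L ≤ M → Even L → Even M → let sh : (Literature.Probability.LatticeModels.TorusSite 2 L × ZMod M) → (Fin r × Fin r × Fin r) → (Literature.Probability.LatticeModels.TorusSite 2 L × ZMod M) := fun s w => (s.1 + ![((w.1 : ℕ) : ZMod L), ((w.2.1 : ℕ) : ZMod L)], s.2 + ((w.2.2 : ℕ) : ZMod M)); let F : ((Fin r × Fin r × Fin r) → ℝ) → ℂ := fun (φ : (Fin r × Fin r × Fin r) → ℝ) => c.sum (fun n a => a * Complex.exp (Complex.I * ((∑ w, (n w : ℝ) * φ w : ℝ) : ℂ))); let A : ((Literature.Probability.LatticeModels.TorusSite 2 L × ZMod M) → ℝ) → ℂ := fun θ => (K : ℂ) * ∑ s : (Literature.Probability.LatticeModels.TorusSite 2 L × ZMod M), F (fun w => θ (sh s w)); let cube : Set ((Literature.Probability.LatticeModels.TorusSite 2 L × ZMod M) → ℝ) := Set.pi Set.univ (fun _ => Set.Icc (0:ℝ) (2 * Real.pi));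 let Z : ℂ := MeasureTheory.integral (MeasureTheory.volume.restrict cube) (fun θ => Complex.exp (-(A θ))); let O : ((Literature.Probability.LatticeModels.TorusSite 2 L × ZMod M) → ℝ) → ℝ := fun θ => ‖∑ x : Literature.Probability.LatticeModels.TorusSite 2 L, Complex.exp (Complex.I * (θ (x, 0) : ℂ))‖ ^ 2 / (L : ℝ) ^ 4; 0 < Z.re ∧ Z.im = 0 ∧ (1/2 : ℝ) ≤ (MeasureTheory.integral (MeasureTheory.volume.restrict cube) (fun θ => (O θ : ℂ) * Complex.exp (-(A θ)))).re / Z.re)) :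
    BirComplexStableXYR := by
  intro r B c₀ hr hc₀
  obtain ⟨K₀, L₀, H⟩ := hpos r B c₀ hr hc₀
  refine ⟨K₀, L₀, ?_⟩
  intro K hK c hU1 hN hA hC hR hP L M _ _ hL0 hLM hLe hMe
  have hRf := timeReflection_functional_of_table r c hR
  have hZreal : conj (partZ K c L M) = partZ K c L M := by
    have h1 := partitionFunction_conj_eq_self r c K L M hRf
    dsimp only at h1
    dsimp only [partZ, action, genF, sh, cube]
    exact h1
  have hNreal : conj (∫ θ, ((((‖∑ x : TorusSite 2 L, Complex.exp (Complex.I * (θ (x, 0) : ℂ))‖ ^ 2 / (L : ℝ) ^ 4 : ℝ)) : ℂ) * Complex.exp (-(action K c L M θ))) ∂(volume.restrict (cube L M))) = (∫ θ, ((((‖∑ x : TorusSite 2 L, Complex.exp (Complex.I * (θ (x, 0) : ℂ))‖ ^ 2 / (L : ℝ) ^ 4 : ℝ)) : ℂ) * Complex.exp (-(action K c L M θ))) ∂(volume.restrict (cube L M))) := by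
    have h1 := sliceOrderNumerator_conj_eq_self r c K L M hRf
    dsimp only at h1
    dsimp only [action, genF, sh, cube]
    exact h1
  have hraw : 0 < (partZ K c L M).re ∧ (partZ K c L M).im = 0 ∧
      (1/2 : ℝ) ≤ (∫ θ, ((((‖∑ x : TorusSite 2 L, Complex.exp (Complex.I * (θ (x, 0) : ℂ))‖ ^ 2 / (L : ℝ) ^ 4 : ℝ)) : ℂ) * Complex.exp (-(action K c L M θ))) ∂(volume.restrict (cube L M))).re / (partZ K c L M).re := by
    have h1 := H K hK c hU1 hN hA hC hR hP L M hL0 hLM hLe hMe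
    dsimp only at h1
    dsimp only [partZ, action, genF, sh, cube]
    exact h1
  obtain ⟨h1, -, h3⟩ := hraw
  have key : partZ K c L M ≠ 0 ∧ (1/2 : ℝ) ≤ ((∫ θ, ((((‖∑ x : TorusSite 2 L, Complex.exp (Complex.I * (θ (x, 0) : ℂ))‖ ^ 2 / (L : ℝ) ^ 4 : ℝ)) : ℂ) * Complex.exp (-(action K c L M θ))) ∂(volume.restrict (cube L M))) / partZ K c L M).re := by
    refine ⟨fun h0 => ?_, ?_⟩
    · rw [h0, Complex.zero_re] at h1
      exact lt_irrefl 0 h1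
    · rw [(re_div_of_conj_eq_self hZreal hNreal).2]
      exact h3
  dsimp only [partZ, action, genF, sh, cube] at key
  dsimp only
  exact key

/-- `BirComplexStableXYR` is EQUIVALENT to its positive form. -/
theorem birComplexStableXYR_iff_pos :
    BirComplexStableXYR ↔ (∀ (r : ℕ) (B c₀ : ℝ), 2 ≤ r → 0 < c₀ → ∃ K₀ : ℝ, ∃ L₀ : ℕ, ∀ K : ℝ, K₀ ≤ K → ∀ c : ((Fin r × Fin r × Fin r) → ℤ) →₀ ℂ, (∀ n ∈ c.support, ∑ w, n w = 0) → c.sum (fun _ a => a) = 0 → c.sum (fun n a => ‖a‖ * Real.exp (∑ w, |(n w : ℝ)|)) ≤ B → (∀ φ : (Fin r × Fin r × Fin r) → ℝ, c₀ * ∑ w, ∑ w', (1 - Real.cos (φ w - φ w')) ≤ ((fun (φ : (Fin r × Fin r × Fin r) → ℝ) => c.sum (fun n a => a * Complex.exp (Complex.I * ((∑ w, (n w : ℝ) * φ w : ℝ) : ℂ)))) φ).re) → (∀ n : (Fin r × Fin r × Fin r) → ℤ, c (fun w => n (w.1, w.2.1, Fin.rev w.2.2)) = (starRingEnd ℂ)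 (c (-n))) → (∀ n : (Fin r × Fin r × Fin r) → ℤ, c (fun w => n (Fin.rev w.1, Fin.rev w.2.1, w.2.2)) = c n) → ∀ (L M : ℕ) [NeZero L] [NeZero M], L₀ ≤ L → L ≤ M → Even L → Even M → let sh : (Literature.Probability.LatticeModels.TorusSite 2 L × ZMod M) → (Fin r × Fin r × Fin r) → (Literature.Probability.LatticeModels.TorusSite 2 L × ZMod M) := fun s w => (s.1 + ![((w.1 : ℕ) : ZMod L), ((w.2.1 : ℕ) : ZMod L)], s.2 + ((w.2.2 : ℕ) : ZMod M)); let F : ((Fin r × Fin r × Fin r) → ℝ) → ℂ := fun (φ : (Fin r × Fin r × Fin r) → ℝ) => c.sum (fun n a => a * Complex.exp (Complex.I * ((∑ w, (n w : ℝ) * φ w : ℝ) : ℂ))); let A : ((Literature.Probability.LatticeModels.TorusSite 2 L × ZMod M) → ℝ) → ℂ := fun θ => (K : ℂ) * ∑ s : (Literature.Probability.LatticeModels.TorusSite 2 L × ZMod M), F (fun w => θ (sh s w)); let cube : Set ((Literature.Probability.LatticeModels.TorusSite 2 L × ZMod M) → ℝ) := Set.pi Set.univ (fun _ => Set.Icc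 (0:ℝ) (2 * Real.pi)); let Z : ℂ := MeasureTheory.integral (MeasureTheory.volume.restrict cube) (fun θ => Complex.exp (-(A θ))); let O : ((Literature.Probability.LatticeModels.TorusSite 2 L × ZMod M) → ℝ) → ℝ := fun θ => ‖∑ x : Literature.Probability.LatticeModels.TorusSite 2 L, Complex.exp (Complex.I * (θ (x, 0) : ℂ))‖ ^ 2 / (L : ℝ) ^ 4; 0 < Z.re ∧ Z.im = 0 ∧ (1/2 : ℝ) ≤ (MeasureTheory.integral (MeasureTheory.volume.restrict cube) (fun θ => (O θ : ℂ) * Complex.exp (-(A θ)))).re / Z.re) :=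
  ⟨birComplexStableXYR_pos, birComplexStableXYR_of_pos⟩

/-- **For item stmt-14846.** The re-typed reduction `BirGappedPhaseReductionR :=
BirComplexStableXYR → BirBdGPhaseCoercivity → BirGroundStateAverageLRO` may consume the POSITIVE
engine: whoever derives the target from (positive partition functions on the whole admissible class
∧ slice order ≥ 1/2) and crux 3 has proved the item as typed. -/
theorem birGappedPhaseReductionR_of_pos
    (h : (∀ (r : ℕ) (B c₀ : ℝ), 2 ≤ r → 0 < c₀ → ∃ K₀ : ℝ, ∃ L₀ : ℕ, ∀ K : ℝ, K₀ ≤ K → ∀ c : ((Fin r × Fin r × Fin r) → ℤ) →₀ ℂ, (∀ n ∈ c.support, ∑ w, n w = 0) → c.sum (fun _ a => a) = 0 → c.sum (fun n a => ‖a‖ * Real.exp (∑ w, |(n w : ℝ)|)) ≤ B → (∀ φ : (Fin r × Fin r × Fin r) → ℝ, c₀ * ∑ w, ∑ w', (1 - Real.cos (φ w - φ w')) ≤ ((fun (φ : (Fin r × Fin r × Fin r) → ℝ) => c.sum (fun n a => a * Complex.exp (Complex.I * ((∑ w, (n w : ℝ) * φ w : ℝ) : ℂ)))) φ).re) → (∀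 n : (Fin r × Fin r × Fin r) → ℤ, c (fun w => n (w.1, w.2.1, Fin.rev w.2.2)) = (starRingEnd ℂ) (c (-n))) → (∀ n : (Fin r × Fin r × Fin r) → ℤ, c (fun w => n (Fin.rev w.1, Fin.rev w.2.1, w.2.2)) = c n) → ∀ (L M : ℕ) [NeZero L] [NeZero M], L₀ ≤ L → L ≤ M → Even L → Even M → let sh : (Literature.Probability.LatticeModels.TorusSite 2 L × ZMod M) → (Fin r × Fin r × Fin r) → (Literature.Probability.LatticeModels.TorusSite 2 L × ZMod M) := fun s w => (s.1 + ![((w.1 : ℕ) : ZMod L), ((w.2.1 : ℕ) : ZMod L)], s.2 + ((w.2.2 : ℕ) : ZMod M)); let F : ((Fin r × Fin r × Fin r) → ℝ) → ℂ := fun (φ : (Fin r × Fin r × Fin r) → ℝ) => c.sum (fun n a => a * Complex.exp (Complex.I * ((∑ w, (n w : ℝ) * φ w : ℝ) : ℂ))); let A : ((Literature.Probability.LatticeModels.TorusSite 2 L × ZMod M) → ℝ) → ℂ := fun θ => (K : ℂ) * ∑ s : (Literature.Probability.LatticeModels.TorusSite 2 L × ZMod M), F (fun w => θ (sh s w)); let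 cube : Set ((Literature.Probability.LatticeModels.TorusSite 2 L × ZMod M) → ℝ) := Set.pi Set.univ (fun _ => Set.Icc (0:ℝ) (2 * Real.pi)); let Z : ℂ := MeasureTheory.integral (MeasureTheory.volume.restrict cube) (fun θ => Complex.exp (-(A θ))); let O : ((Literature.Probability.LatticeModels.TorusSite 2 L × ZMod M) → ℝ) → ℝ := fun θ => ‖∑ x : Literature.Probability.LatticeModels.TorusSite 2 L, Complex.exp (Complex.I * (θ (x, 0) : ℂ))‖ ^ 2 / (L : ℝ) ^ 4; 0 < Z.re ∧ Z.im = 0 ∧ (1/2 : ℝ) ≤ (MeasureTheory.integral (MeasureTheory.volume.restrict cube) (fun θ => (O θ : ℂ) * Complex.exp (-(A θ)))).re / Z.re) → BirBdGPhaseCoercivity → BirGroundStateAverageLRO) :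
    BirGappedPhaseReductionR :=
  fun h2R h3 => h (birComplexStableXYR_pos h2R) h3

/-- … and conversely, so the item is EQUIVALENT to the reduction from the positive engine. -/
theorem birGappedPhaseReductionR_iff_pos :
    BirGappedPhaseReductionR ↔ ((∀ (r : ℕ) (B c₀ : ℝ), 2 ≤ r → 0 < c₀ → ∃ K₀ : ℝ, ∃ L₀ : ℕ, ∀ K : ℝ, K₀ ≤ K → ∀ c : ((Fin r × Fin r × Fin r) → ℤ) →₀ ℂ, (∀ n ∈ c.support, ∑ w, n w = 0) → c.sum (fun _ a => a) = 0 → c.sum (fun n a => ‖a‖ * Real.exp (∑ w, |(n w : ℝ)|)) ≤ B → (∀ φ : (Fin r × Fin r × Fin r) → ℝ, c₀ * ∑ w, ∑ w', (1 - Real.cos (φ w - φ w')) ≤ ((fun (φ : (Fin r × Fin r × Fin r) → ℝ) => c.sum (fun n a => a * Complex.exp (Complex.I * ((∑ w, (n w : ℝ) * φ w : ℝ) : ℂ)))) φ).re) → (∀ n : (Fin r × Fin r × Fin r) → ℤ, c (fun w => n (w.1, w.2.1, Fin.rev w.2.2)) = (starRingEnd ℂ) (c (-n))) → (∀ n : (Fin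 r × Fin r × Fin r) → ℤ, c (fun w => n (Fin.rev w.1, Fin.rev w.2.1, w.2.2)) = c n) → ∀ (L M : ℕ) [NeZero L] [NeZero M], L₀ ≤ L → L ≤ M → Even L → Even M → let sh : (Literature.Probability.LatticeModels.TorusSite 2 L × ZMod M) → (Fin r × Fin r × Fin r) → (Literature.Probability.LatticeModels.TorusSite 2 L × ZMod M) := fun s w => (s.1 + ![((w.1 : ℕ) : ZMod L), ((w.2.1 : ℕ) : ZMod L)], s.2 + ((w.2.2 : ℕ) : ZMod M)); let F : ((Fin r × Fin r × Fin r) → ℝ) → ℂ := fun (φ : (Fin r × Fin r × Fin r) → ℝ) => c.sum (fun n a => a * Complex.exp (Complex.I * ((∑ w, (n w : ℝ) * φ w : ℝ) : ℂ))); let A : ((Literature.Probability.LatticeModels.TorusSite 2 L × ZMod M) → ℝ) → ℂ := fun θ => (K : ℂ) * ∑ s : (Literature.Probability.LatticeModels.TorusSite 2 L × ZMod M), F (fun w => θ (sh s w)); let cube : Set ((Literature.Probability.LatticeModels.TorusSite 2 L × ZMod M) → ℝ) := Set.pi Set.univ (fun _ => Set.Icc (0:ℝ) (2 * Real.pi));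 let Z : ℂ := MeasureTheory.integral (MeasureTheory.volume.restrict cube) (fun θ => Complex.exp (-(A θ))); let O : ((Literature.Probability.LatticeModels.TorusSite 2 L × ZMod M) → ℝ) → ℝ := fun θ => ‖∑ x : Literature.Probability.LatticeModels.TorusSite 2 L, Complex.exp (Complex.I * (θ (x, 0) : ℂ))‖ ^ 2 / (L : ℝ) ^ 4; 0 < Z.re ∧ Z.im = 0 ∧ (1/2 : ℝ) ≤ (MeasureTheory.integral (MeasureTheory.volume.restrict cube) (fun θ => (O θ : ℂ) * Complex.exp (-(A θ)))).re / Z.re) → BirBdGPhaseCoercivity → BirGroundStateAverageLRO) :=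
  ⟨fun h4 hp h3 => h4 (birComplexStableXYR_of_pos hp) h3, birGappedPhaseReductionR_of_pos⟩

end Summit.HubbardSuperconductivity.HubbardSuperconductivity.Theorems

end
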